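import Mathlib
import Literature.NumberTheory.LFunctions.Zhang2022.SkeletonLemma59R
import HarnessLib

/-!
# Zhang (2022) §5, Lemma 5.9 on its use-range from the WINDOWED Proposition 2.2 (`Prop22W`)

Topic `Literature/NumberTheory/LFunctions/Zhang2022` (Landau–Siegel audit tree; verdict-neutral;
D-0069 campaign nodes **Z22:Lem5.9** / **Z22:Lem5.9.pf**, locator [Z22 p.29–30, §5 Lemma 5.9 and
(5.16), tex L1630–L1664]; cone leaf `h59 : Skeleton.Lemma59AR c′` of
`Skeleton.theorem1_of_leaves_v11`).
Y. Zhang, *Discrete mean estimates and the Landau–Siegel zero*, arXiv:2211.02515v1 (2022)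
[Zhang2022LandauSiegel] — **an unrefereed manuscript under adjudication**.

**What this file establishes (theorems only, no new definition, no named fact).** sz-d14's kernel
deduction `Skeleton.lemma59_restricted_of_prop22` (`Section5Lemma59Ded`: Proposition 2.2 ⇒
Lemma 5.9 with `β₁ = iα(1−5c′α𝓛)` on the height range `|t − 2πt₀| ≤ 𝓛₁ + 1/4`) is re-run from the
WEAKER node of record `Skeleton.Prop22W c′ = (i) ∧ (ii) ∧ Prop22iiiW c′` (`SkeletonProp22W`), in
which the gap assertion (iii) is only available for consecutive pairs whose LOWER zero has
`|γ − 2πt₀| < 𝓛₁ + 3/2`. The one place where (iii) enters Lemma 5.9's proof is the pairwise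
separation of the zeros of `L(s,ψ)` in the Jensen disc `|ρ − (2+it)| ≤ 81/50`
(`Lemma59Ded.discZeros_separated`), and there the lower zero is always a disc zero. By
Proposition 2.2 (i) every disc zero lies on the critical line, so `Re(ρ − (2+it)) = −3/2` and hence
`|Im ρ − t|² ≤ (81/50)² − (3/2)² = 936/2500 < (5/8)²`; with `|t − 2πt₀| ≤ 𝓛₁ + 1/4` this puts every
disc zero at height `|Im ρ − 2πt₀| < 𝓛₁ + 7/8 < 𝓛₁ + 3/2`, inside the window of `Prop22iiiW`.
Everything else is sz-d14's proof verbatim (adapted with attribution).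

* `Lemma59Ded.gap_of_consecutiveW`, `Lemma59Ded.discZeros_separatedW` — the windowed forms of
  the two combinatorial lemmas of `Section5Lemma59DedPrelims`;
* `Lemma59Ded.abs_im_sub_lt_of_mem_discZeros_of_re` — the height confinement of on-line disc zeros;
* `Skeleton.lemma59_restricted_of_prop22W` — `0 ≤ c′ → Prop22W c′ →` (Lemma 5.9 on `𝓛₁ + 1/4`);
* `Skeleton.lemma59A_restricted_of_prop22W` — the same in the (A)-form;
* `Skeleton.lemma59AR_of_prop22W : 0 ≤ c′ → Prop22W c′ → Lemma59AR c′` — **the cone leaf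
  `h59 : Lemma59AR c′` of `theorem1_of_leaves_v11` is a consequence of the chain-internal
  `h22 : Prop22W c′`** (the discharge "requested from sz-d14" in `SkeletonLemma59R`'s docstring).

WHAT THIS IS NOT: any statement about Theorems 1–2 of the manuscript or about Landau–Siegel
zeros; `Prop22W` stays a CLAIM node (hypothesis here). Typed ≠ proved.

## References

* Y. Zhang, arXiv:2211.02515v1 (2022), §5 Lemma 5.9, (5.16); §2 (2.7), (2.10), (2.13),
  Proposition 2.2 (iii) restated p. 5. [cite: Zhang2022LandauSiegel, §5 Lemma 5.9]
* H. L. Montgomery, R. C. Vaughan, *Multiplicative Number Theory I*, CUP 2007, Lemma 12.1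
  (through the tree's `DirichletLogDerivDisc.lean`). [cite: MontgomeryVaughan2007, Lemma 12.1]
-/

noncomputable section

open Complex Real Set Metric Filter _root_.Topology Finset

namespace Literature.NumberTheory.LFunctions.Zhang2022

namespace Lemma59Ded

open Skeleton Literature.NumberTheory.LFunctions.DirichletDisc

/-! ### The windowed combinatorics of Proposition 2.2 (iii) -/

/-- **From consecutive gaps to pairwise gaps, windowed form.** If the zeros of `L(s,ψ)L(s,ψχ)` in
`Ω` form a finite set and consecutive ones whose LOWER zero has `|γ − 2πt₀| < 𝓛₁ + 3/2` satisfy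
`|γ′ − γ − α| < c′α²𝓛` (Proposition 2.2 (iii), inner-window form `Prop22iiiW` at `ψ`), then any two
zeros `γ < γ′` with the lower one in that window satisfy `γ′ − γ > α − c′α²𝓛` (take the first zero
above `γ`). Adapted from `gap_of_consecutive` (sz-d14). [cite: Zhang2022LandauSiegel, §2 Prop. 2.2 (iii)] -/
theorem gap_of_consecutiveW {D : ℕ} [NeZero D] {χ : DirichletCharacter ℂ D} {x : Chr D} {c' : ℝ}
    (hfin : (prodZeroSetOmega χ x).Finite)
    (hiii : ∀ s ∈ prodZeroSetOmega χ x, ∀ s' ∈ prodZeroSetOmega χ x,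
      |s.im - 2 * π * t0 D| < ell1 D + 3 / 2 → s.im < s'.im →
      (∀ s'' ∈ prodZeroSetOmega χ x, ¬ (s.im < s''.im ∧ s''.im < s'.im)) →
        |s'.im - s.im - alpha D| < c' * alpha D ^ 2 * ell D)
    {ρ ρ' : ℂ} (hρ : ρ ∈ prodZeroSetOmega χ x) (hρ' : ρ' ∈ prodZeroSetOmega χ x)
    (hρw : |ρ.im - 2 * π * t0 D| < ell1 D + 3 / 2)
    (hlt : ρ.im < ρ'.im) : alpha D - c' * alpha D ^ 2 * ell D < ρ'.im - ρ.im := by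
  classical
  -- the zeros strictly above `ρ` and not above `ρ'`, as a finite set; it contains `ρ'`
  set S : Finset ℂ := hfin.toFinset.filter (fun u => ρ.im < u.im ∧ u.im ≤ ρ'.im) with hS
  have hρ'S : ρ' ∈ S := by
    rw [hS, Finset.mem_filter, Set.Finite.mem_toFinset]
    exact ⟨hρ', hlt, le_rfl⟩
  obtain ⟨u₀, hu₀S, hu₀min⟩ := S.exists_min_image (fun u => u.im) ⟨ρ', hρ'S⟩
  rw [hS, Finset.mem_filter, Set.Finite.mem_toFinset] at hu₀S
  obtain ⟨hu₀Z, hu₀lt, hu₀le⟩ := hu₀S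
  -- `ρ` and `u₀` are consecutive
  have hcons : ∀ s'' ∈ prodZeroSetOmega χ x, ¬ (ρ.im < s''.im ∧ s''.im < u₀.im) := by
    rintro s'' hs'' ⟨h1, h2⟩
    have hs''S : s'' ∈ S := by
      rw [hS, Finset.mem_filter, Set.Finite.mem_toFinset]
      exact ⟨hs'', h1, le_trans h2.le hu₀le⟩
    have := hu₀min s'' hs''S
    linarith
  have h := hiii ρ hρ u₀ hu₀Z hρw hu₀lt hcons
  rw [abs_lt] at h
  linarith [h.1]

/-- **A disc zero on the critical line sits at height `|Im ρ − t| < 5/8`.** For `ρ` in the Jensen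
disc `|ρ − (2+it)| ≤ 81/50` with `Re ρ = 1/2`: `(3/2)² + (Im ρ − t)² ≤ (81/50)²`, i.e.
`(Im ρ − t)² ≤ 936/2500 < (5/8)²`. [cite: Zhang2022LandauSiegel, §2 Prop. 2.2 (i)] -/
theorem abs_im_sub_lt_of_mem_discZeros_of_re {D : ℕ} (x : Chr D) {t : ℝ} {ρ : ℂ}
    (hρ : ρ ∈ discZeros x.ψ t) (hre : ρ.re = 1 / 2) : |ρ.im - t| < 5 / 8 := by
  obtain ⟨hball, -⟩ := (mem_discZeros x.ψ_ne_one).1 hρ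
  rw [Metric.mem_closedBall, dist_eq_norm] at hball
  have hre' : (ρ - (2 + (t : ℂ) * I)).re = -(3 / 2) := by simp [hre]; norm_num
  have him' : (ρ - (2 + (t : ℂ) * I)).im = ρ.im - t := by simp
  have hsq : (ρ - (2 + (t : ℂ) * I)).re ^ 2 + (ρ - (2 + (t : ℂ) * I)).im ^ 2
      = ‖ρ - (2 + (t : ℂ) * I)‖ ^ 2 := by
    rw [Complex.sq_norm, Complex.normSq_apply]; ring
  have hn0 : 0 ≤ ‖ρ - (2 + (t : ℂ) * I)‖ := norm_nonneg _
  have hnsq : ‖ρ - (2 + (t : ℂ) * I)‖ ^ 2 ≤ (81 / 50 : ℝ) ^ 2 := pow_le_pow_left₀ hn0 hball 2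
  rw [hre', him'] at hsq
  have h2 : (ρ.im - t) ^ 2 < (5 / 8 : ℝ) ^ 2 := by nlinarith
  exact abs_lt_of_sq_lt_sq h2 (by norm_num)

/-- **Proposition 2.2 (i)+(iii)W ⇒ the disc zeros are `g`-separated in ordinate** for any
`g ≤ α − c′α²𝓛`, once the disc zeros are zeros of `L(s,ψ)L(s,ψχ)` in `Ω` lying on the line and
inside the height window `|Im ρ − 2πt₀| < 𝓛₁ + 3/2` of `Prop22iiiW`. Adapted from
`discZeros_separated` (sz-d14). [cite: Zhang2022LandauSiegel, §2 Prop. 2.2 (iii)] -/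
theorem discZeros_separatedW {D : ℕ} [NeZero D] {χ : DirichletCharacter ℂ D} {x : Chr D}
    {c' t g : ℝ} (hfin : (prodZeroSetOmega χ x).Finite)
    (hiii : ∀ s ∈ prodZeroSetOmega χ x, ∀ s' ∈ prodZeroSetOmega χ x,
      |s.im - 2 * π * t0 D| < ell1 D + 3 / 2 → s.im < s'.im →
      (∀ s'' ∈ prodZeroSetOmega χ x, ¬ (s.im < s''.im ∧ s''.im < s'.im)) →
        |s'.im - s.im - alpha D| < c' * alpha D ^ 2 * ell D)
    (hZΩ : ∀ ρ ∈ discZeros x.ψ t, ρ ∈ prodZeroSetOmega χ x)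
    (hline : ∀ ρ ∈ discZeros x.ψ t, ρ.re = 1 / 2)
    (hwin : ∀ ρ ∈ discZeros x.ψ t, |ρ.im - 2 * π * t0 D| < ell1 D + 3 / 2)
    (hg : g ≤ alpha D - c' * alpha D ^ 2 * ell D) :
    ∀ ρ ∈ discZeros x.ψ t, ∀ ρ' ∈ discZeros x.ψ t, ρ ≠ ρ' → g ≤ |ρ.im - ρ'.im| := by
  intro ρ hρ ρ' hρ' hne
  have hne_im : ρ.im ≠ ρ'.im := by
    intro h
    exact hne (Complex.ext (by rw [hline ρ hρ, hline ρ' hρ']) h)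
  rcases lt_or_gt_of_ne hne_im with hlt | hlt
  · have h := gap_of_consecutiveW hfin hiii (hZΩ ρ hρ) (hZΩ ρ' hρ') (hwin ρ hρ) hlt
    rw [abs_sub_comm, abs_of_pos (by linarith)]
    linarith
  · have h := gap_of_consecutiveW hfin hiii (hZΩ ρ' hρ') (hZΩ ρ hρ) (hwin ρ' hρ') hlt
    rw [abs_of_pos (by linarith)]
    linarith

end Lemma59Ded

namespace Skeleton

open Lemma59Ded Literature.NumberTheory.LFunctions.DirichletDisc

/-- **Lemma 5.9 ⇐ Proposition 2.2 (WINDOWED form `Prop22W`), on the height range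
`|t − 2πt₀| ≤ 𝓛₁ + 1/4`** (DAG `Z22:Lem5.9.pf`; printed proof [Z22 p.30, tex L1636–L1664]): for every
`c′ ≥ 0`, if `Skeleton.Prop22W c′` holds then for every `c₀ > 0` there is `C` such that for all large
`D`, every real primitive `χ (mod D)`, every `ψ ∈ Ψ₁`, and every `s = σ + it` with `|σ − 1/2| ≤ α`,
`|t − 2πt₀| ≤ 𝓛₁ + 1/4` and `|s − ρ| ≥ c₀α` for all zeros `ρ` of `L(·,ψ)`:
`‖L(s+β₁,ψ)/L(s,ψ)‖ ≤ C log P`. sz-d14's `lemma59_restricted_of_prop22` verbatim except that the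
pairwise separation of the Jensen-disc zeros is taken from `Prop22iiiW` via `discZeros_separatedW`
(the disc zeros are on the line by (i), hence at heights `< 𝓛₁ + 7/8 < 𝓛₁ + 3/2`).
[cite: Zhang2022LandauSiegel, §5 Lemma 5.9] -/
theorem lemma59_restricted_of_prop22W {c' : ℝ} (hc' : 0 ≤ c') (h22 : Prop22W c') :
    ∀ c₀ : ℝ, 0 < c₀ → ∃ C : ℝ, ForAllLarge fun D _ χ => ∀ x ∈ PsiOne χ, ∀ s : ℂ,
      |s.re - 1 / 2| ≤ alpha D → |s.im - 2 * π * t0 D| ≤ ell1 D + 1 / 4 →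
        (∀ ρ : ℂ, x.ψ.LFunction ρ = 0 → c₀ * alpha D ≤ ‖s - ρ‖) →
          ‖x.ψ.LFunction (s + beta1 c' D) / x.ψ.LFunction s‖ ≤ C * Real.log (bigP D) := by
  -- adapted from Section5Lemma59Ded.lean (sz-d14), `lemma59_restricted_of_prop22`
  intro c₀ hc₀
  obtain ⟨h22i, h22ii, h22iii⟩ := h22
  obtain ⟨C, hC0, hC⟩ := Lemma59.norm_le_of_prop22
  -- the scale-free constants
  set κ : ℝ := min c₀ 1 / 2 with hκdef
  have hκ0 : 0 < κ := by rw [hκdef]; positivity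
  have hκ : κ ≤ 1 / 2 := by
    rw [hκdef]; linarith [min_le_right c₀ 1]
  have hκc₀ : 2 * κ ≤ c₀ := by rw [hκdef]; linarith [min_le_left c₀ 1]
  set Bκ : ℝ := 3 / 2 * Real.log (4 / κ ^ 2) + 2 / κ + Real.log (2 / κ) + 1 / κ ^ 2 with hBκ
  set K : ℝ := Real.exp (3 * Real.pi * C + Bκ) / Real.pi with hKdef
  refine ⟨K, ?_⟩
  -- thresholds: Proposition 2.2's `D₀`, and `𝓛 ≥ 32 + 40c′`
  obtain ⟨D₁, hD₁⟩ := (h22i.and h22ii).and h22iii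
  refine ⟨max D₁ ⌈Real.exp (32 + 40 * c')⌉₊, fun D _ χ hD hq hp x hx s hσ ht hfar => ?_⟩
  obtain ⟨⟨hi, hii⟩, hiii⟩ := hD₁ D χ (le_trans (le_max_left _ _) hD) hq hp
  have hDceil : ⌈Real.exp (32 + 40 * c')⌉₊ ≤ D := le_trans (le_max_right _ _) hD
  have hexp : Real.exp (32 + 40 * c') ≤ D := le_trans (Nat.le_ceil _) (by exact_mod_cast hDceil)
  have hD0 : (0 : ℝ) < D := lt_of_lt_of_le (Real.exp_pos _) hexp
  have hLc : 32 + 40 * c' ≤ ell D := (Real.le_log_iff_exp_le hD0).mpr hexp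
  have hL : 32 ≤ ell D := by linarith
  have hL1 : 1 ≤ ell D := by linarith
  have hL0 : 0 < ell D := by linarith
  have hD3 : 3 ≤ D := by
    have h3 : (3 : ℝ) ≤ Real.exp (32 + 40 * c') := by
      have := Real.add_one_le_exp (32 + 40 * c'); linarith
    exact_mod_cast h3.trans hexp
  -- the scales `α = π/𝓛⁹`, `v₁ = α(1 − 5c′α𝓛)`, `g = α − c′α²𝓛`
  have hlogP : Real.log (bigP D) = ell D ^ 9 := by rw [bigP, Real.log_exp]
  have hα : alpha D = Real.pi / ell D ^ 9 := by rw [alpha, hlogP]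
  obtain ⟨hα0, hα100, hcαL⟩ := scales hc' hLc hα
  obtain ⟨hv₁0, hv₁α, hv₁g, hgα⟩ := shifts hc' hα0 hL0.le hcαL
  set v₁ : ℝ := alpha D * (1 - 5 * c' * alpha D * ell D) with hv₁def
  set g : ℝ := alpha D - c' * alpha D ^ 2 * ell D with hgdef
  have hg0 : 0 < g := by linarith
  have hv₁100 : v₁ ≤ 1 / 100 := hv₁α.trans hα100
  have hβ₁ : beta1 c' D = (v₁ : ℂ) * I := by
    rw [beta1, hv₁def]; push_cast; ring
  -- the zero data at height `t = Im s`: on the line, simple, in the window, `g`-separated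
  set t : ℝ := s.im with htdef
  have hψ1 : x.ψ ≠ 1 := x.ψ_ne_one
  have hfin := Lemma59Ded.prodZeroSetOmega_finite χ x hD3 hp
  have hZΩ : ∀ ρ ∈ discZeros x.ψ t, ρ ∈ prodZeroSetOmega χ x := fun ρ hρ =>
    mem_prodZeroSetOmega_of_mem_discZeros χ x ht hρ
  have hline : ∀ ρ ∈ discZeros x.ψ t, ρ.re = 1 / 2 := fun ρ hρ => hi x hx ρ (hZΩ ρ hρ)
  have hsimple : ∀ ρ ∈ discZeros x.ψ t, discDivisor x.ψ t ρ = 1 := fun ρ hρ =>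
    discDivisor_eq_one_of_deriv_ne_zero χ x hρ (hii x hx ρ (hZΩ ρ hρ))
  have hwin : ∀ ρ ∈ discZeros x.ψ t, |ρ.im - 2 * π * t0 D| < ell1 D + 3 / 2 := by
    intro ρ hρ
    have h1 : |ρ.im - t| < 5 / 8 := abs_im_sub_lt_of_mem_discZeros_of_re x hρ (hline ρ hρ)
    have h2 : |ρ.im - 2 * π * t0 D| ≤ |ρ.im - t| + |t - 2 * π * t0 D| :=
      abs_sub_le ρ.im t (2 * π * t0 D)
    linarith
  have hgap : ∀ ρ ∈ discZeros x.ψ t, ∀ ρ' ∈ discZeros x.ψ t, ρ ≠ ρ' → g ≤ |ρ.im - ρ'.im| :=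
    discZeros_separatedW hfin (hiii x hx) hZΩ hline hwin (by rw [hgdef])
  -- the size of `Cℒv₁` and of the zero-sum terms: `exp(Cℒv₁ + B) ≤ K log P`
  have hℒ : Real.log x.p + Real.log (|t| + 4) ≤ 3 * ell D ^ 9 := ell_disc_le hL x ht
  have hbook := bookkeeping_le hα0 hα100 hκ0 hκ hgα hv₁0 hv₁g hv₁α
  have hexpK := exp_bound_le hC0.le hL0 hα hℒ hv₁0.le hv₁α hbook
  rw [← hlogP] at hexpK
  -- the core estimate at an abscissa `σ′ ≠ 1/2` within `κα` of `σ`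
  have hcore : ∀ σ' : ℝ, |σ' - 1 / 2| ≤ alpha D → σ' ≠ 1 / 2 → |σ' - s.re| ≤ κ * alpha D →
      ‖x.ψ.LFunction ((σ' : ℂ) + t * I + v₁ * I)‖
        ≤ ‖x.ψ.LFunction ((σ' : ℂ) + t * I)‖ * (K * Real.log (bigP D)) := by
    intro σ' hσ' hσ'ne hσ'σ
    have hσ'100 : |σ' - 1 / 2| ≤ 1 / 100 := hσ'.trans hα100
    -- zero-free segment (off the line, all disc zeros are on the line)
    have hseg : ∀ y ∈ Set.Icc (0 : ℝ) v₁, x.ψ.LFunction ((σ' : ℂ) + t * I + y * I) ≠ 0 := by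
      intro y hy h0
      have hmem : (σ' : ℂ) + t * I + y * I ∈ discZeros x.ψ t :=
        (mem_discZeros hψ1).2 ⟨mem_disc hσ'100 hy.1 (hy.2.trans hv₁100), h0⟩
      have hre := hline _ hmem
      simp only [Complex.add_re, Complex.ofReal_re, Complex.mul_re, Complex.I_re, Complex.I_im,
        Complex.ofReal_im, mul_zero, mul_one, sub_self, add_zero] at hre
      exact hσ'ne hre
    -- distance `≥ κα` from the zeros
    have hdist : ∀ ρ ∈ discZeros x.ψ t, κ * alpha D ≤ ‖(σ' : ℂ) + t * I - ρ‖ := fun ρ hρ =>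
      dist_ge hα0.le hκc₀ (hfar ρ (discZeros_prop hψ1 hρ).1) hσ'σ
    have hκα81 : κ * alpha D ≤ 81 / 50 := by
      have : κ * alpha D ≤ 1 / 2 * (1 / 100) := mul_le_mul hκ hα100 hα0.le (by norm_num)
      linarith
    have h := hC x.p x.ψ hψ1 σ' t v₁ (alpha D) g (κ * alpha D) hσ' hα100 hv₁0 hv₁100 hg0
      (by positivity) hκα81 hseg hline hsimple hgap hdist
    exact h.trans (mul_le_mul_of_nonneg_left (by rw [hKdef]; exact hexpK) (norm_nonneg _))
  -- `L(s) ≠ 0` (distance `c₀α > 0` from every zero)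
  have hLs : x.ψ.LFunction s ≠ 0 := by
    intro h0
    have := hfar s h0
    rw [sub_self, norm_zero] at this
    have := mul_pos hc₀ hα0
    linarith
  have hs_eq : s = (s.re : ℂ) + t * I := by rw [htdef]; exact (Complex.re_add_im s).symm
  -- the estimate at `s` itself: directly off the line, by continuity on the line
  have hmain : ‖x.ψ.LFunction (s + (v₁ : ℂ) * I)‖
      ≤ ‖x.ψ.LFunction s‖ * (K * Real.log (bigP D)) := by
    by_cases hσhalf : s.re = 1 / 2
    · -- `σ = 1/2`: approach from `σ′ = 1/2 + δ`, `δ → 0⁺`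
      have hcont : Continuous x.ψ.LFunction :=
        (DirichletCharacter.differentiable_LFunction hψ1).continuous
      have hδ : ∀ δ ∈ Set.Ioo (0 : ℝ) (κ * alpha D),
          ‖x.ψ.LFunction (((1 / 2 + δ : ℝ) : ℂ) + t * I + v₁ * I)‖
            ≤ ‖x.ψ.LFunction (((1 / 2 + δ : ℝ) : ℂ) + t * I)‖ * (K * Real.log (bigP D)) := by
        intro δ hδ
        have h1 : |(1 / 2 + δ) - 1 / 2| ≤ alpha D := by
          rw [show (1 : ℝ) / 2 + δ - 1 / 2 = δ by ring, abs_of_pos hδ.1]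
          have : κ * alpha D ≤ alpha D := mul_le_of_le_one_left hα0.le (by linarith)
          linarith [hδ.2]
        have h2 : (1 : ℝ) / 2 + δ ≠ 1 / 2 := by linarith [hδ.1]
        have h3 : |(1 / 2 + δ) - s.re| ≤ κ * alpha D := by
          rw [hσhalf, show (1 : ℝ) / 2 + δ - 1 / 2 = δ by ring, abs_of_pos hδ.1]; exact hδ.2.le
        exact hcore (1 / 2 + δ) h1 h2 h3
      have h := norm_le_at_half_of_right hcont (by positivity) hδ
      have e0 : (((1 / 2 : ℝ) : ℂ) + (t : ℂ) * I) = s := by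
        rw [hs_eq, hσhalf]
      rwa [e0] at h
    · have h := hcore s.re hσ hσhalf (by rw [sub_self, abs_zero]; positivity)
      rwa [← hs_eq] at h
  -- conclude
  have hK0 : 0 ≤ K * Real.log (bigP D) := by rw [hKdef, hlogP]; positivity
  rw [hβ₁, norm_div, div_le_iff₀ (norm_pos_iff.mpr hLs)]
  calc ‖x.ψ.LFunction (s + (v₁ : ℂ) * I)‖ ≤ ‖x.ψ.LFunction s‖ * (K * Real.log (bigP D)) := hmain
    _ = K * Real.log (bigP D) * ‖x.ψ.LFunction s‖ := by ring

/-- The same deduction in the PRINT-FAITHFUL (A)-form (the (A) antecedent is not used), from the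
windowed `Prop22W c′`. [cite: Zhang2022LandauSiegel, §5 Lemma 5.9] -/
theorem lemma59A_restricted_of_prop22W {c' : ℝ} (hc' : 0 ≤ c') (h22 : Prop22W c') :
    ∀ c₀ : ℝ, 0 < c₀ → ∃ C : ℝ, ForAllLarge fun D _ χ => AssumptionA D χ → ∀ x ∈ PsiOne χ, ∀ s : ℂ,
      |s.re - 1 / 2| ≤ alpha D → |s.im - 2 * π * t0 D| ≤ ell1 D + 1 / 4 →
        (∀ ρ : ℂ, x.ψ.LFunction ρ = 0 → c₀ * alpha D ≤ ‖s - ρ‖) →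
          ‖x.ψ.LFunction (s + beta1 c' D) / x.ψ.LFunction s‖ ≤ C * Real.log (bigP D) := by
  intro c₀ hc₀
  obtain ⟨C, D₀, h⟩ := lemma59_restricted_of_prop22W hc' h22 c₀ hc₀
  exact ⟨C, D₀, fun D _ χ hD hq hp _ x hx s hσ ht hfar => h D χ hD hq hp x hx s hσ ht hfar⟩

/-- **The cone leaf `h59 : Lemma59AR c′` of `Skeleton.theorem1_of_leaves_v11` follows from the
chain-internal `Prop22W c′`** (for every `c′ ≥ 0` — the whole-DAG theorem carries `hc′ : 0 ≤ c′` and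
derives `h22 : Prop22W c′` from `Ded22W`): Lemma 5.9 in the (A)-form on its use-range `𝓛₁ + 1/4`
(`SkeletonLemma59R`) is literally the conclusion of `lemma59A_restricted_of_prop22W`. In the next
re-thread, `have h59 : Lemma59AR c' := lemma59AR_of_prop22W hc' h22`.
[cite: Zhang2022LandauSiegel, §5 Lemma 5.9] -/
theorem lemma59AR_of_prop22W {c' : ℝ} (hc' : 0 ≤ c') (h22 : Prop22W c') : Lemma59AR c' :=
  lemma59A_restricted_of_prop22W hc' h22

end Skeleton

end Literature.NumberTheory.LFunctions.Zhang2022
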